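import Literature.AlgebraicGeometry.Frobenioids.ArithmeticRealificationPicDegree
import Literature.AlgebraicGeometry.Frobenioids.ArithmeticFrobenioids
import Literature.AlgebraicGeometry.Frobenioids.Prop53Sub
import HarnessLib

/-!
# Frobenioids I, Thm. 6.4 (i): THE `ArithRealification` of `C_{K/F}` — `C_{K/F}^rlf`, `Pic_Φ`, and
# `δ_A : Pic_Φ(A) ⥲ ℝ`

Mochizuki, *The geometry of Frobenioids I*, Kyushu J. Math. **62** (2008), Thm. 6.4 (i) p. 114, last sentence:
"Finally, if `A ∈ Ob(C^rlf)` is a Frobenius-trivial object that projects to the object of `D` determined by a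
finite extension `L ⊆ F̃` of `F`, then `deg^arith_L` determines an isomorphism of groups `δ_A : Pic_Φ(A) ⥲ ℝ` [cf.
Theorem 5.1, (i)]"; proof p. 115: "to show that the surjection `δ_A : Pic_Φ(A) ↠ ℝ` is, in fact, an isomorphism,
it suffices to verify that the image of `Φ^birat(L) ⊗_ℤ ℝ = (L^×) ⊗_ℤ ℝ` in `(Φ^rlf_factor)^gp(L)` is equal to the
set of elements of `(Φ^rlf_factor)^gp(L)` with finite support whose image under `deg^arith_L` is `0`";
Thm. 5.1 (i) p. 96 (`Pic_Φ(A) := Φ^gp(A)/Φ^birat(A)`); Prop. 5.3 p. 103 (the realification `C^rlf`)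
[cite: MochizukiFrdI2008, Thm. 6.4 (i) p.114] [cite: MochizukiFrdI2008, Thm. 5.1 p.96]
[cite: MochizukiFrdI2008, Prop. 5.3 p.103].

This file INSTANTIATES the interface `ArithRealification` of abc-iut-L1-t3 (`ArithmeticFrobenioids.lean`: "INTERFACE for
the realification `C^rlf` (Prop. 5.3) of the arithmetic Frobenioid together with `Pic_Φ` (Thm. 5.1) on its
Frobenius-trivial objects and the isomorphisms `δ_A : Pic_Φ(A) ≃ ℝ` determined by `deg^arith_L` … seat abc-iut-L1-t2
(`TODO-merge`) owns `C^rlf`/`Pic_Φ`") at THE constructions, for every perf-factoriality witness `hΦ` of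
`Φ = arithDivisorFunctor F K` (sub-DAG `plan/L1/SUBDAG-FrdI-Thm64.md` row T64i/L15, interface level; L1-lead R108 (3)):

* `Rlf := C_{K/F}^rlf = PreFrobenioid.rlf (ModelFrobenioid.toElem Φ B Div_B) hΦ` (Prop. 5.3 at THE data,
  `FrobenioidRealificationCanonical.lean`), `ops := FrdI.Cor54Sub.rlfData … hΦ` (abc-iut-w5-d137's packaging);
* `Pic A := Additive (Pic (Base A))` with `Pic X = (Φ^rlf)^gp(X) ⧸ (ℝ · Φ^birat)(X)` — abc-iut-L1-t5's `GpSubfunctor.Pic`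
  of THE `ℝ · Φ^birat = (RealificationData.canonical Φ _).realSpan Φ^birat` (Thm. 5.1 (i) for the realified data);
* `δ A _ := ArithRlfPic.picDegreeAddEquiv hΦ (Base A)`: THE degree `ArithRlfPic.rlfDegree` (the unique extension of
  `deg^arith_L` to `Φ(L)^rlf`, `existsUnique_rlf_arithDegree`) groupified, read in `ℝ`, descended to `Pic`
  (`ArithRlfPic.picDegree`), which is BIJECTIVE (`ArithRlfPic.arith_picDegree_bijective`,
  `ArithmeticRealificationPicDegree.lean`) — so `δ_A` is defined for EVERY object, in particular the Frobenius-trivial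
  ones, and `arithRealification_δ_mk_iota` records "`deg^arith_L` determines … `δ_A`" (its value on the class of `ι(D)` is `deg^arith_L(D)`).

Definitions + their defining lemmas only (review lane); the mathematics is in the proof-only companions
`ArithmeticRealificationCoordQ/Coordinates/PicDegree.lean`.  Seat abc-iut-L1-d2 (cell abc-iut).
-/

noncomputable section

open scoped NNReal

namespace Literature.AlgebraicGeometry.Frobenioids

open CategoryTheory Opposite Function NumberField Literature.AnabelianGeometry.EtaleTheta

namespace ArithRlfPic

variable {F : Type} [Field F] [NumberField F] {K : Type} [Field K] [Algebra F K]
  (hΦ : PreFrobenioid.IsPerfFactorialOn (arithDivisorFunctor F K)) (X : FinSubextCat F K)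

/-- **THE degree `d_L : Φ(L)^rlf → ℝ_{≥0}`** — the extension of `deg^arith_L` to THE realification of `Φ(L)`
(unique: `existsUnique_rlf_arithDegree`; named through `arith_exists_rlfDegree`).
[cite: MochizukiFrdI2008, Thm. 6.4 (i) p.115] -/
def rlfDegree : (PreFrobenioid.IsPerfFactorialOn.op hΦ (op X)).Rlf →* Multiplicative ℝ≥0 :=
  (arith_exists_rlfDegree hΦ X).choose

/-- `d_L (ι D) = deg^arith_L(D)` for every effective arithmetic divisor `D`. [cite: MochizukiFrdI2008, Thm. 6.4 (i) p.115] -/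
theorem rlfDegree_iota (D : EffArithDivisor X.L) :
    ((Multiplicative.toAdd (rlfDegree hΦ X ((PreFrobenioid.IsPerfFactorialOn.op hΦ (op X)).toRealification
      (Perfection.of _ (Multiplicative.ofAdd D)))) : ℝ≥0) : ℝ) =
      arithDegree X.L (EffArithDivisor.toArithDivisor X.L D) :=
  (arith_exists_rlfDegree hΦ X).choose_spec D

/-- **THE descended degree `δ_L : Pic_Φ(Spec L) → ℝ`** (multiplicatively rendered): `((ℝ_{≥0})^gp → ℝ) ∘ d_L^gp`
descended to `Pic = (Φ^rlf)^gp(L) ⧸ (ℝ · Φ^birat)(L)`, which it kills (`arith_realSpan_le_ker`).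
[cite: MochizukiFrdI2008, Thm. 6.4 (i) p.115] -/
def picDegree :
    ((RealificationData.canonical (arithDivisorFunctor F K) (PreFrobenioid.IsPerfFactorialOn.op hΦ)).realSpan
        (PreFrobenioid.biratSubfunctor
          (ModelFrobenioid.toElem (arithDivisorFunctor F K) (unitsFunctor F K) (divNatTrans F K)))).Pic X →*
      Multiplicative ℝ :=
  QuotientGroup.lift _
    ((Algebra.GrothendieckGroup.lift
      (NNReal.toRealHom.toAddMonoidHom.toMultiplicative : Multiplicative ℝ≥0 →* Multiplicative ℝ)).comp
      (MonGp.map (rlfDegree hΦ X)))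
    fun x hx => by
      have hx' : MonGp.map (rlfDegree hΦ X) x = 1 := arith_realSpan_le_ker hΦ X _ (rlfDegree_iota hΦ X) hx
      show Algebra.GrothendieckGroup.lift _ (MonGp.map (rlfDegree hΦ X) x) = 1
      rw [hx', map_one]

/-- Defining property: `δ_L ∘ (quotient map) = ((ℝ_{≥0})^gp → ℝ) ∘ d_L^gp`. [cite: MochizukiFrdI2008, Thm. 6.4 (i) p.115] -/
theorem picDegree_comp_mk' :
    (picDegree hΦ X).comp (QuotientGroup.mk' _) =
      (Algebra.GrothendieckGroup.lift
        (NNReal.toRealHom.toAddMonoidHom.toMultiplicative : Multiplicative ℝ≥0 →* Multiplicative ℝ)).comp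
        (MonGp.map (rlfDegree hΦ X)) :=
  QuotientGroup.lift_comp_mk' _ _ _

/-- **`δ_L` is bijective** (`arith_picDegree_bijective` at THE degree). [cite: MochizukiFrdI2008, Thm. 6.4 (i) p.114] -/
theorem picDegree_bijective : Bijective (picDegree hΦ X) :=
  arith_picDegree_bijective hΦ X _ (rlfDegree_iota hΦ X) _ (picDegree_comp_mk' hΦ X)

/-- **`δ_L` on the class of `ι(D)` is `deg^arith_L(D)`**. [cite: MochizukiFrdI2008, Thm. 6.4 (i) p.114] -/
theorem picDegree_mk_iota (D : EffArithDivisor X.L) :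
    picDegree hΦ X (QuotientGroup.mk' _ (Algebra.GrothendieckGroup.of
      ((PreFrobenioid.IsPerfFactorialOn.op hΦ (op X)).toRealification (Perfection.of _ (Multiplicative.ofAdd D))))) =
      Multiplicative.ofAdd (arithDegree X.L (EffArithDivisor.toArithDivisor X.L D)) :=
  arith_picDegree_mk_iota hΦ X _ (rlfDegree_iota hΦ X) _ (picDegree_comp_mk' hΦ X) D

/-- **`δ : Pic_Φ(Spec L) ⥲ ℝ` as an isomorphism of (additively written) abelian groups**, determined by `deg^arith_L`.
[cite: MochizukiFrdI2008, Thm. 6.4 (i) p.114] -/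
def picDegreeAddEquiv :
    Additive (((RealificationData.canonical (arithDivisorFunctor F K) (PreFrobenioid.IsPerfFactorialOn.op hΦ)).realSpan
        (PreFrobenioid.biratSubfunctor
          (ModelFrobenioid.toElem (arithDivisorFunctor F K) (unitsFunctor F K) (divNatTrans F K)))).Pic X) ≃+ ℝ :=
  MulEquiv.toAdditiveLeft (MulEquiv.ofBijective (picDegree hΦ X) (picDegree_bijective hΦ X))

/-- `picDegreeAddEquiv` is `picDegree` read additively. [cite: MochizukiFrdI2008, Thm. 6.4 (i) p.114] -/
theorem picDegreeAddEquiv_apply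
    (x : ((RealificationData.canonical (arithDivisorFunctor F K) (PreFrobenioid.IsPerfFactorialOn.op hΦ)).realSpan
        (PreFrobenioid.biratSubfunctor
          (ModelFrobenioid.toElem (arithDivisorFunctor F K) (unitsFunctor F K) (divNatTrans F K)))).Pic X) :
    picDegreeAddEquiv hΦ X (Additive.ofMul x) = Multiplicative.toAdd (picDegree hΦ X x) := rfl

end ArithRlfPic

section Instance

variable {F : Type} [Field F] [NumberField F] {K : Type} [Field K] [Algebra F K]
  (hΦ : PreFrobenioid.IsPerfFactorialOn (arithDivisorFunctor F K))

/-- **THE `ArithRealification` of `C_{K/F}`** (Thm. 6.4 (i), last sentence, at THE constructions): the realified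
arithmetic Frobenioid `C_{K/F}^rlf` (Prop. 5.3) with its operations over `D = FinSubextCat F K`, THE
`Pic_Φ(A) = (Φ^rlf)^gp(Base A) ⧸ (ℝ · Φ^birat)(Base A)` (Thm. 5.1 (i)), and THE `δ_A : Pic_Φ(A) ⥲ ℝ` determined by
`deg^arith` (defined — and an isomorphism — for every object `A`, in particular the Frobenius-trivial ones).
[cite: MochizukiFrdI2008, Thm. 6.4 (i) p.114] -/
def arithRealification :
    ArithRealification (F := F) (K := K)
      (PreFrobenioid.rlf (ModelFrobenioid.toElem (arithDivisorFunctor F K) (unitsFunctor F K) (divNatTrans F K)) hΦ) where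
  ops := FrdI.Cor54Sub.rlfData
    (ModelFrobenioid.toElem (arithDivisorFunctor F K) (unitsFunctor F K) (divNatTrans F K)) hΦ
  Pic A := Additive
    (((RealificationData.canonical (arithDivisorFunctor F K) (PreFrobenioid.IsPerfFactorialOn.op hΦ)).realSpan
      (PreFrobenioid.biratSubfunctor
        (ModelFrobenioid.toElem (arithDivisorFunctor F K) (unitsFunctor F K) (divNatTrans F K)))).Pic A.base)
  δ A _ := ArithRlfPic.picDegreeAddEquiv hΦ A.base

/-- The operations of THE `ArithRealification` are those of `C_{K/F}^rlf → F_{Φ^rlf}`.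
[cite: MochizukiFrdI2008, Prop. 5.3 p.103] -/
theorem arithRealification_ops :
    (arithRealification hΦ).ops =
      FrdI.Cor54Sub.rlfData
        (ModelFrobenioid.toElem (arithDivisorFunctor F K) (unitsFunctor F K) (divNatTrans F K)) hΦ := rfl

/-- `Pic_Φ(A)` of THE `ArithRealification` is (additively) `(Φ^rlf)^gp(Base A) ⧸ (ℝ · Φ^birat)(Base A)`.
[cite: MochizukiFrdI2008, Thm. 5.1 p.96] -/
theorem arithRealification_Pic
    (A : PreFrobenioid.rlf (ModelFrobenioid.toElem (arithDivisorFunctor F K) (unitsFunctor F K) (divNatTrans F K)) hΦ) :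
    (arithRealification hΦ).Pic A = Additive
      (((RealificationData.canonical (arithDivisorFunctor F K) (PreFrobenioid.IsPerfFactorialOn.op hΦ)).realSpan
        (PreFrobenioid.biratSubfunctor
          (ModelFrobenioid.toElem (arithDivisorFunctor F K) (unitsFunctor F K) (divNatTrans F K)))).Pic A.base) := rfl

/-- `δ_A` of THE `ArithRealification` is `picDegreeAddEquiv` at `Base A` (for every Frobenius-triviality witness).
[cite: MochizukiFrdI2008, Thm. 6.4 (i) p.114] -/
theorem arithRealification_δ
    (A : PreFrobenioid.rlf (ModelFrobenioid.toElem (arithDivisorFunctor F K) (unitsFunctor F K) (divNatTrans F K)) hΦ)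
    (hA : (arithRealification hΦ).ops.IsFrobeniusTrivial A) :
    (arithRealification hΦ).δ A hA = ArithRlfPic.picDegreeAddEquiv hΦ A.base := rfl

/-- **"`deg^arith_L` determines … `δ_A`"**: `δ_A` of THE `ArithRealification` sends the class of `ι(D)`, `D ∈ Φ(L)` an
effective arithmetic divisor on `L = Base A`, to `deg^arith_L(D)`. [cite: MochizukiFrdI2008, Thm. 6.4 (i) p.114] -/
theorem arithRealification_δ_mk_iota
    (A : PreFrobenioid.rlf (ModelFrobenioid.toElem (arithDivisorFunctor F K) (unitsFunctor F K) (divNatTrans F K)) hΦ)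
    (hA : (arithRealification hΦ).ops.IsFrobeniusTrivial A) (D : EffArithDivisor A.base.L) :
    (arithRealification hΦ).δ A hA (Additive.ofMul (QuotientGroup.mk' _ (Algebra.GrothendieckGroup.of
      ((PreFrobenioid.IsPerfFactorialOn.op hΦ (op A.base)).toRealification
        (Perfection.of _ (Multiplicative.ofAdd D)))))) =
      arithDegree A.base.L (EffArithDivisor.toArithDivisor A.base.L D) := by
  show Multiplicative.toAdd (ArithRlfPic.picDegree hΦ A.base (QuotientGroup.mk' _ (Algebra.GrothendieckGroup.of
    ((PreFrobenioid.IsPerfFactorialOn.op hΦ (op A.base)).toRealification (Perfection.of _ (Multiplicative.ofAdd D)))))) = _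
  rw [ArithRlfPic.picDegree_mk_iota, toAdd_ofAdd]

end Instance

end Literature.AlgebraicGeometry.Frobenioids

end
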